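import Literature.NumberTheory.Automorphic.UnitaryGroupArithmeticLevels
import Literature.NumberTheory.Automorphic.UnramifiedLevelChange
import Mathlib.Topology.Algebra.Group.ClosedSubgroup
import HarnessLib

/-!
# The normal core of a compact open subgroup in another; normal-core arithmetic levels

For subgroups `K, K'` of a group `B`, the **normal core of `K'` in `K`** — the largest subgroup of `K ∩ K'`
normalised by `K`, i.e. `⋂_{k ∈ K} k (K ∩ K') k⁻¹` — as a subgroup `Subgroup.coreIn K K'` of the AMBIENT group `B`
(Mathlib's `Subgroup.normalCore` of `K'.subgroupOf K : Subgroup K`, pushed forward along `K ↪ B`).  It is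
`≤ K`, `≤ K'`, normal in `K` (`normal_coreIn_subgroupOf`) and of finite index in `K` as soon as `K ∩ K'` is
(`finiteIndex_coreIn_subgroupOf`).  In a topological group, **the normal core of an open subgroup `K'` in a
COMPACT OPEN subgroup `K` is again compact open** (`Subgroup.isOpen_coreIn`, `isCompact_coreIn`): `K ∩ K'` has
finite index in the compact `K` (tree `Subgroup.finiteIndex_subgroupOf_of_isCompact_isOpen`), so its normal core is
a closed subgroup of finite index of `K` (Mathlib `Subgroup.normalCore_isClosed`,
`Subgroup.isOpen_of_isClosed_of_finiteIndex`), hence open in `K`, hence in `B`.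

Application (`UnitaryGroup.normal_arithmeticLevel_coreIn_subgroupOf`,
`….finiteIndex_arithmeticLevel_coreIn_subgroupOf`): for compact open levels `K, K'` of the finite-adelic unitary
group (tree `UnitaryGroupArithmeticLevels`: `Γ(K) = G(F) ∩ K`), the arithmetic group of the normal core,
`Γ(K_N)`, is a NORMAL subgroup of FINITE INDEX of `Γ(K)` contained in `Γ(K) ∩ Γ(K')` (through the tree's
`UnitaryGroup.arithmeticLevel_subgroupOf : Γ(K″) ∩ Γ(K) = (Γ(K) → K)⁻¹(K″ ∩ K)`) — the Galois intermediate level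
through which a Hecke correspondence `Γ' \ D ⇉ Γ \ D` of arithmetic quotients is dominated by a finite GALOIS
covering `Γ_N \ D → Γ \ D`.

`Subgroup.coreIn` and its lemmas are DELIBERATE dot-notation extensions of Mathlib's `Subgroup` namespace (pure
group theory / topological groups, stated for any group); the arithmetic-level statements live in this file's
path namespace.  Cell pub-hodgecm2, lane «L-BYPASS» (kernel text by the seat pub-hodgecm2-s2crux-idea-2, probe
`RA-v29`, gen 8; filed by b10).  No named fact.

References: J. Rotman, *An Introduction to the Theory of Groups* (4th ed., 1995), Ch. 3 (representation on
cosets; the core of a subgroup) [Rotman1995]; V. Platonov, A. Rapinchuk, *Algebraic Groups and Number Theory* (1994), §4.1 (arithmetic and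
congruence subgroups; commensurability) [PlatonovRapinchuk1994]; G. Shimura, *Introduction to the Arithmetic
Theory of Automorphic Functions* (1971), Ch. 3 §3.1 and §3.3 (commensurable subgroups, double cosets)
[ShimuraIATAF1971].
-/

set_option autoImplicit false

/-! ## The normal core of `K'` in `K` as a subgroup of the ambient group -/

namespace Subgroup

variable {B : Type*} [Group B]

/-- **The normal core of `K'` in `K`**, as a subgroup of the ambient group: the largest subgroup of `K ∩ K'`
normalised by `K` (Mathlib `Subgroup.normalCore` of `K'.subgroupOf K`, pushed forward along `K ↪ B`).  A deliberate
dot-notation extension of Mathlib's `Subgroup` namespace.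
[cite: Rotman1995, Ch. 3 (representation on cosets; the core of a subgroup)] -/
def coreIn (K K' : Subgroup B) : Subgroup B := ((K'.subgroupOf K).normalCore).map K.subtype

/-- `coreIn K K' ≤ K`. [cite: Rotman1995, Ch. 3 (representation on cosets; the core of a subgroup)] -/
theorem coreIn_le_left (K K' : Subgroup B) : K.coreIn K' ≤ K := Subgroup.map_subtype_le _

/-- Seen inside `K`, `coreIn K K'` is Mathlib's normal core of `K' ∩ K`.
[cite: Rotman1995, Ch. 3 (representation on cosets; the core of a subgroup)] -/
theorem coreIn_subgroupOf (K K' : Subgroup B) : (K.coreIn K').subgroupOf K = (K'.subgroupOf K).normalCore := by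
  rw [coreIn, Subgroup.subgroupOf, Subgroup.comap_map_eq_self_of_injective K.subtype_injective]

/-- `coreIn K K' ≤ K'`. [cite: Rotman1995, Ch. 3 (representation on cosets; the core of a subgroup)] -/
theorem coreIn_le_right (K K' : Subgroup B) : K.coreIn K' ≤ K' := by
  rintro _ ⟨y, hy, rfl⟩
  exact Subgroup.mem_subgroupOf.mp (Subgroup.normalCore_le _ hy)

/-- `coreIn K K'` is normal in `K`. [cite: Rotman1995, Ch. 3 (representation on cosets; the core of a subgroup)] -/
instance normal_coreIn_subgroupOf (K K' : Subgroup B) : ((K.coreIn K').subgroupOf K).Normal := by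
  rw [coreIn_subgroupOf]; infer_instance

/-- `coreIn K K'` has finite index in `K` when `K ∩ K'` has (the normal core of a finite-index subgroup has
finite index). [cite: Rotman1995, Ch. 3 (representation on cosets; the core of a subgroup)] -/
instance finiteIndex_coreIn_subgroupOf (K K' : Subgroup B) [(K'.subgroupOf K).FiniteIndex] :
    ((K.coreIn K').subgroupOf K).FiniteIndex := by
  rw [coreIn_subgroupOf]; infer_instance

/-- `k c k⁻¹ ∈ coreIn K K'` for `k ∈ K`, `c ∈ coreIn K K'` (membership form of normality).
[cite: Rotman1995, Ch. 3 (representation on cosets; the core of a subgroup)] -/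
theorem conj_mem_coreIn {K K' : Subgroup B} {k c : B} (hk : k ∈ K) (hc : c ∈ K.coreIn K') :
    k * c * k⁻¹ ∈ K.coreIn K' := by
  have hcK : c ∈ K := coreIn_le_left K K' hc
  have h := (normal_coreIn_subgroupOf K K').conj_mem ⟨c, hcK⟩ (Subgroup.mem_subgroupOf.mpr hc) ⟨k, hk⟩
  exact Subgroup.mem_subgroupOf.mp h

section Topology

variable [TopologicalSpace B] [IsTopologicalGroup B]

/-- **The normal core of an open subgroup `K'` in a compact open subgroup `K` is open**: `K ∩ K'` has finite index
in the compact `K`, so its normal core is closed of finite index in `K`, hence open.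
[cite: PlatonovRapinchuk1994, §4.1] -/
theorem isOpen_coreIn {K K' : Subgroup B} (hKc : IsCompact (K : Set B)) (hK : IsOpen (K : Set B))
    (hK' : IsOpen (K' : Set B)) : IsOpen (K.coreIn K' : Set B) := by
  have hH : IsOpen ((K'.subgroupOf K : Subgroup K) : Set K) := hK'.preimage continuous_subtype_val
  haveI : (K'.subgroupOf K).FiniteIndex :=
    Literature.NumberTheory.Automorphic.Subgroup.finiteIndex_subgroupOf_of_isCompact_isOpen hKc hK'
  have hC : IsOpen (((K'.subgroupOf K).normalCore : Subgroup K) : Set K) :=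
    Subgroup.isOpen_of_isClosed_of_finiteIndex _
      (Subgroup.normalCore_isClosed _ (Subgroup.isClosed_of_isOpen _ hH))
  have e : (K.coreIn K' : Set B) = ((↑) : K → B) '' (((K'.subgroupOf K).normalCore : Subgroup K) : Set K) := by
    rw [coreIn, Subgroup.coe_map, Subgroup.coe_subtype]
  rw [e]
  exact hK.isOpenMap_subtype_val _ hC

/-- … and compact (a closed subset of the compact `K`). [cite: PlatonovRapinchuk1994, §4.1] -/
theorem isCompact_coreIn {K K' : Subgroup B} (hKc : IsCompact (K : Set B)) (hK : IsOpen (K : Set B))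
    (hK' : IsOpen (K' : Set B)) : IsCompact (K.coreIn K' : Set B) :=
  hKc.of_isClosed_subset (Subgroup.isClosed_of_isOpen _ (isOpen_coreIn hKc hK hK'))
    (fun _ hx => coreIn_le_left K K' hx)

end Topology

end Subgroup

/-! ## Normal-core arithmetic levels of the unitary group -/

open scoped NumberField

namespace Literature.NumberTheory.Automorphic

namespace UnitaryGroup

variable {F E : Type} [Field F] [Field E] [NumberField E] [Algebra F E]
  {c : E ≃ₐ[F] E} {N : ℕ} {J : Matrix (Fin N) (Fin N) E}

/-- **`Γ(K_N) ⊴ Γ(K)`** for the normal core `K_N = coreIn K K'` of a level `K'` in a level `K`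
(`Γ(K_N) = (Γ(K) → K)⁻¹(K_N)` and `K_N ⊴ K`). [cite: ShimuraIATAF1971, Ch. 3 §3.1 and §3.3] -/
theorem normal_arithmeticLevel_coreIn_subgroupOf (K K' : Subgroup (finAdelic F E c N J)) :
    ((arithmeticLevel F E c N J (K.coreIn K')).subgroupOf (arithmeticLevel F E c N J K)).Normal := by
  rw [arithmeticLevel_subgroupOf]
  exact Subgroup.Normal.comap inferInstance _

/-- **`[Γ(K) : Γ(K_N)] < ∞`** when `[K : K ∩ K'] < ∞` (e.g. `K` compact open, `K'` open).
[cite: ShimuraIATAF1971, Ch. 3 §3.1 and §3.3] -/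
theorem finiteIndex_arithmeticLevel_coreIn_subgroupOf (K K' : Subgroup (finAdelic F E c N J))
    [(K'.subgroupOf K).FiniteIndex] :
    ((arithmeticLevel F E c N J (K.coreIn K')).subgroupOf (arithmeticLevel F E c N J K)).FiniteIndex := by
  rw [arithmeticLevel_subgroupOf]
  exact Subgroup.finiteIndex_comap_of_finiteIndex _ _

/-- The arithmetic group of the normal core lies in `Γ(K) ∩ Γ(K')`. [cite: ShimuraIATAF1971, Ch. 3 §3.1] -/
theorem arithmeticLevel_coreIn_le_inf (K K' : Subgroup (finAdelic F E c N J)) :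
    arithmeticLevel F E c N J (K.coreIn K') ≤ arithmeticLevel F E c N J K ⊓ arithmeticLevel F E c N J K' :=
  le_inf (arithmeticLevel_mono (Subgroup.coreIn_le_left K K')) (arithmeticLevel_mono (Subgroup.coreIn_le_right K K'))

end UnitaryGroup

end Literature.NumberTheory.Automorphic
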